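import Summits.CriticalPhenomena.PercolationContinuityZ3.Theorems.Transplant.SkelNegBParamsSlotsRS
import Summits.CriticalPhenomena.PercolationContinuityZ3.Theorems.Transplant.SkelNegBParamsRootA
import HarnessLib

/-!
# N1 params, chain of record `NegB`, part BridgeF: THE WIDE BRIDGE PAIR FOR THE y′-FACE — clearance `bF c := M_u + (c+2)·RA′ + 1`, zone index
# `mbF c := max (2·bF + 26) (24·M_u + 63)`, pair `(MBF, nBF) := (MB D mbF, nB D mbF bF)`, data `hBF/ℓBF/vBF`, the extra-pair slot `PxF c : PSlot`, and the facts
# `RF2F` / `MBF_floors` / `bridgeF_adm` / `ℓBF_ge` / **`clearF : M_u + (c+1)·RA′ < nBF − RA′`** (stmt-g15 2026-08-22; (L-F1) menu items (ii)/(iii) of p1-g13 01:09:22Z,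
# priced at the lane INBOX 01:14:14Z: c := 1000 absorbs the y′-run's recession (Nr+1)·R′s ≤ 1001·RA′ so that the α-clearance holds for every region from the k = 0 floor;
# c := 4 absorbs regions k ≤ 3)
Why a SECOND pair and not a wider `KS.nBR`: the (R) column's landed instantiations read `KS.nBR/hBR/ℓBR/vBR` (SlotsRS); a wider bridge for the y′-face is served
through the pair slot `Px` of `KS.PR mk Px` instead (the node's (R)/(C) wrappers are general in `Px`). Everything is the generic part-B API
(`MB/nB/hB/ℓB/vB`, `nB_facts`, `MB_facts`, `bridge_adm`, `ℓB_ge`) at `(mb, b) := (mbF c, bF c)` — exactly as SlotsRS does at `(mbR, bR)`. Legal order: κ → kit (`RA′`, `M_u`)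
→ bridge; `c` is a κ-free count today (≤ 1001), `1000·Kq + 1` under (ζ′) — still chosen after κ.
builds on p205010 (kernel theorem, internal audit signed; external expert review pending) — nothing in this file uses p205010; NOTHING is claimed about
the node `SamePDropOfSkeletonNeg₁` (OPEN; its (F) column is blocked on the named LEVEL-0 statement `hlin`, lead g7 RULING E2; B.19 under refutation).
Lane `prim-bschramm-*`, seat `prim-bschramm-stmt` (gen 15); helper file (`--supports stmt-CriticalPhenomena-4575 --as helper`); ledger HOME/prim-bschramm-stmt/NEG-PARAMS.md.
* `KS.bF/mbF/MBF/nBF/hBF/ℓBF/vBF`, `bF_facts`, `mbF_floors`, **`RF2F`**, **`MBF_floors`**, **`bridgeF_adm`**, **`ℓBF_ge`**, **`clearF`**, **`PxF`**, `mem_PxF`.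
[cite: KozmaNitzan2024, §4 Lemma 11 (pp. 22–23)] [cite: MartineauTassion2017, §3.2 Lemma 3.5]
-/

noncomputable section

open scoped Classical

namespace Summit.CriticalPhenomena.PercolationContinuityZ3.Theorems.Transplant

namespace PlanarSkeletonNeg

namespace NegB

open Literature.Probability.Percolation Literature.Probability.LatticeModels SimpleGraph
open SkelConc (Consts)
open Skelφ.StepI (DataN)
open Neg

namespace KS

section BridgeF

variable (κ : Consts) {V : Type} [Countable V] {G : SimpleGraph V} [G.LocallyFinite] (Φ : PlanarSkeletonNeg G) (t : V)
  (p : unitInterval) (D : DataN V) (c mk : ℕ)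

/-- **The y′-face bridge clearance** `bF c := M_u + (c+2)·RA′ + 1`. [this work] -/
def bF : ℕ := Mu D + (c + 2) * RA' κ Φ t p D mk + 1

/-- **The y′-face bridge zone-index floor** `mbF c := max (2·bF + 26) (24·M_u + 63)`. [this work] -/
def mbF : ℕ := max (2 * bF κ Φ t p D c mk + 26) (24 * Mu D + 63)

/-- The y′-face bridge zone index `MBF := MB D mbF`. [this work] -/
abbrev MBF : ℕ := MB D (mbF κ Φ t p D c mk)

/-- The y′-face bridge width `nBF := nB D mbF bF`. [this work] -/
abbrev nBF : ℕ := nB D (mbF κ Φ t p D c mk) (bF κ Φ t p D c mk)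

/-- The y′-face bridge shear. [this work] -/
abbrev hBF : ℤ := hB t D (mbF κ Φ t p D c mk) (bF κ Φ t p D c mk)

/-- The y′-face bridge half-length. [this work] -/
abbrev ℓBF : ℕ := ℓB t D (mbF κ Φ t p D c mk) (bF κ Φ t p D c mk)

/-- The y′-face bridge split point. [this work] -/
abbrev vBF : ℤ := vB t D (mbF κ Φ t p D c mk) (bF κ Φ t p D c mk)

/-- `bF = M_u + (c+2)RA′ + 1`, `M_u ≤ bF`, `(c+2)·RA′ + 1 ≤ bF`, `bR ≤ bF` once `D.k ≤ M_u + c·RA′`. [folklore] -/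
theorem bF_facts : bF κ Φ t p D c mk = Mu D + (c + 2) * RA' κ Φ t p D mk + 1 ∧ Mu D ≤ bF κ Φ t p D c mk ∧ (c + 2) * RA' κ Φ t p D mk + 1 ≤ bF κ Φ t p D c mk :=
  ⟨rfl, by unfold bF; omega, by unfold bF; omega⟩

/-- `2·bF + 26 ≤ mbF` and `24·M_u + 63 ≤ mbF`. [folklore] -/
theorem mbF_floors : 2 * bF κ Φ t p D c mk + 26 ≤ mbF κ Φ t p D c mk ∧ 24 * Mu D + 63 ≤ mbF κ Φ t p D c mk := ⟨le_max_left _ _, le_max_right _ _⟩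

/-- **(R-F2) at the y′-face bridge**: `bF ≤ nBF`, `MBF < nBF`, `MBF + bF + 2 + ρz ≤ nBF`. [folklore] -/
theorem RF2F : bF κ Φ t p D c mk ≤ nBF κ Φ t p D c mk ∧ MBF κ Φ t p D c mk < nBF κ Φ t p D c mk ∧ MBF κ Φ t p D c mk + bF κ Φ t p D c mk + 2 + ρz D ≤ nBF κ Φ t p D c mk :=
  ⟨(nB_facts D _ _).2.2.1, (nB_facts D _ _).2.1, (nB_facts D _ _).2.2.2⟩

/-- **The zone-index floors at the y′-face bridge**: `2·bF + 26 ≤ MBF`, `24·M_u + 63 ≤ MBF`, `M_u ≤ MBF`. [folklore] -/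
theorem MBF_floors : 2 * bF κ Φ t p D c mk + 26 ≤ MBF κ Φ t p D c mk ∧ 24 * Mu D + 63 ≤ MBF κ Φ t p D c mk ∧ Mu D ≤ MBF κ Φ t p D c mk := by
  have h1 := (MB_facts D (mbF κ Φ t p D c mk)).2.1
  have h2 := mbF_floors κ Φ t p D c mk
  exact ⟨h2.1.trans h1, h2.2.trans h1, (MB_facts D _).1⟩

/-- **The y′-face bridge pair is admissible.** [folklore] -/
theorem bridgeF_adm : D.M₀ ≤ (MBF κ Φ t p D c mk, nBF κ Φ t p D c mk).1 ∧ D.n₁ (MBF κ Φ t p D c mk, nBF κ Φ t p D c mk).1 ≤ (MBF κ Φ t p D c mk, nBF κ Φ t p D c mk).2 :=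
  bridge_adm D _ _

/-- **`2·bF + 27 ≤ ℓBF`** from the bridge pair's geometric clause (any map `ψ`). [folklore] -/
theorem ℓBF_ge (ψ : V → Site 2) (hE : D.EqGeom G ψ t (MBF κ Φ t p D c mk) (nBF κ Φ t p D c mk)) : 2 * bF κ Φ t p D c mk + 27 ≤ ℓBF κ Φ t p D c mk := by
  have h1 := ℓB_ge t D (mbF κ Φ t p D c mk) (bF κ Φ t p D c mk) ψ hE
  have h2 := (mbF_floors κ Φ t p D c mk).1
  show _ ≤ ℓB t D (mbF κ Φ t p D c mk) (bF κ Φ t p D c mk)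
  omega

/-- **THE CLEARANCE THE WIDE BRIDGE BUYS**: `M_u + (c+1)·RA′ < nBF − RA′` — with `R′s ≤ RA′` the y′-run's α-recession `(k+1)·R′s` (p1-g13's recession lemma) stays
clear of the zone scale `M_u` for every region `k ≤ c − 1` from the `k = 0` origin at the top of the `hxaY` interval (`c_lo(core1) − n_L = nBF − RA′`). [folklore] -/
theorem clearF : ((Mu D : ℕ) : ℤ) + ((c : ℤ) + 1) * (RA' κ Φ t p D mk : ℤ) < (nBF κ Φ t p D c mk : ℤ) - RA' κ Φ t p D mk := by
  have h1 := (RF2F κ Φ t p D c mk).1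
  have h2 := (bF_facts κ Φ t p D c mk).1
  have h3 : Mu D + (c + 2) * RA' κ Φ t p D mk + 1 ≤ nBF κ Φ t p D c mk := by rw [← h2]; exact h1
  have h4 : ((Mu D + (c + 2) * RA' κ Φ t p D mk + 1 : ℕ) : ℤ) ≤ (nBF κ Φ t p D c mk : ℤ) := by exact_mod_cast h3
  push_cast at h4
  linarith

/-- **THE EXTRA-PAIR SLOT CARRYING THE y′-FACE BRIDGE** `PxF c mk := {(MBF, nBF)}` (with admissibility). [this work] -/
def PxF : PSlot := fun κ _ _ _ _ _ Φ t p D =>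
  ⟨{(MBF κ Φ t p D c mk, nBF κ Φ t p D c mk)}, fun q hq => by rw [Finset.mem_singleton] at hq; subst hq; exact bridgeF_adm κ Φ t p D c mk⟩

/-- The y′-face bridge pair is in `PR mk (PxF c mk)` (and in `PR mk Px` for every `Px ⊇ PxF`'s pairs — here the exact slot). [folklore] -/
theorem mem_PxF [DecidableEq V] : (MBF κ Φ t p D c mk, nBF κ Φ t p D c mk) ∈ (PR mk (PxF c mk) κ Φ t p D).1 := by
  show _ ∈ ({(MBR κ Φ t p D mk, nBR κ Φ t p D mk), (MK D mk, nKit D mk)} ∪ ({(MBF κ Φ t p D c mk, nBF κ Φ t p D c mk)} : Finset (ℕ × ℕ)))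
  exact Finset.mem_union_right _ (Finset.mem_singleton_self _)

end BridgeF

end KS

end NegB

end PlanarSkeletonNeg

end Summit.CriticalPhenomena.PercolationContinuityZ3.Theorems.Transplant

end
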